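/-
Copyright (c) 2026. All rights reserved.
Released under Apache 2.0 license as described in the file LICENSE.
Authors: abc-iut cell, seat abc-iut-f-069 (gen 3; row «P13-V-OFOUTERACTION»).
-/
import Literature.AnabelianGeometry.AbsoluteAnabelian.AbsTopII.DPSCInertiaOfOuterActionZhat

/-!
# [AbsTopII] Prop 1.3 (v) — outer clauses (F-0278) and middle clause (F-0300) — at the CONSTRUCTED DPSC data

S. Mochizuki, *Topics in Absolute Anabelian Geometry II* [AbsTopII] (bib `MochizukiAbsTopII2013`; kurims
manuscript `paper:url-585b8d0ad0d9`), §1 Def 1.2 (ii) p. 10, Prop 1.3 (v) p. 12: "`D_v = C_{Π_H}(I_v) =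
N_{Π_H}(I_v)` (respectively, `D_v ∩ Π_I = C_{Π_I}(I_v) = N_{Π_I}(I_v) = Z_{Π_I}(I_v)`; `D_v ∩ Π_𝔾 = Π_v`) is
commensurably terminal in `Π_H` (respectively, `Π_I`; `Π_𝔾`)", proof p. 16; [CombGC] (bib
`MochizukiCombGC2007`) Prop 1.2 (i)(ii) p. 8, Def 1.4 (i).

PROOF-ONLY assembly (no definition) over abc-iut-L4-t6's closer `prop_1_3_v'_of_prop_1_3_iii'` /
`prop13v_of_prop_1_3_iii'` (`AbsTopII/InertiaDecompositionProofs.lean`, p425615), abc-iut-w5-d226's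
presentation bridge (`DPSCData.ofEmbedding` / `ofOuterAction`, `graphic_presentation`, `graphic_vertSub_of_psc`,
`vertDet_of_psc`, `isCommensurablyTerminal_vertSub_of_psc`, `hconj_ofOuterAction`) and abc-iut-f-069's
`prop_1_3_iii'_ofEmbedding` / `prop_1_3_iii'_ofOuterAction_of_dehn` (p442486 / p443326):

* `DPSCIndexData.prop_1_3_v'_ofEmbedding` — **[AbsTopII] Prop 1.3 (v), middle clause AS TYPED (F-0300,
  `Prop_1_3_v'`) at every embedded datum** from: graphicity of the conjugation action (Def 1.2 (ii)
  "`ρ_H : H → Aut(𝒢) ⊆ Out(Π_𝒢)`"), [CombGC] Prop 1.2 (ii) (F-0438) and (i) (F-0459) for `G`, slimness of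
  `G`'s verticial subgroups (Rmk 1.1.3), "`I_v ↠ I`", "`I_v ≅ Ẑ^Σ`", and row I-L "(iv) at open subgroups"
  (p. 16: "if `I_v ∩ γ·I_v·γ⁻¹ ≠ {1}`, then `Π_v = γ·Π_v·γ⁻¹`");
* `DPSCIndexData.prop13v_ofEmbedding_of_isFreeProSigmaCyclic` — t4's outer clauses (F-0278), the
  "`I_v` infinite" hypothesis of abc-iut-w5-d226's `prop13v_ofEmbedding` discharged by "`I_v ≅ Ẑ^Σ`";
* `DPSCIndexData.prop_1_3_v'_ofOuterAction_of_dehn`, `prop13v_ofOuterAction_of_dehn` — the same two at the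
  DPSC-extension `Π_𝒢 ⋊^out_θ J` from hypotheses on the CONSTRUCTION DATA: graphic lifts of `θ`, F-0438,
  F-0459, Rmk 1.1.3, Π_v-fixing lifts of `ρ_I` (profinite Dehn twists), `I` closed with `I ≅ Ẑ^Σ` — plus
  row I-L (the one remaining `Π_I`-level input; cf. abc-iut-f-066's `DPSCData.inputL_of_coverings`).
HONEST FRAMING: assembly of kernel-proved reductions; the named inputs stay hypotheses (typed ≠ proved);
nothing here bears on [IUTchIII] Cor 3.12 or takes a side on any author.
-/

noncomputable section

open scoped Pointwise

namespace Literature.AnabelianGeometry.AbsoluteAnabelian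

open Literature.AlgebraicGeometry.Frobenioids (IsSlimGroup)
open Literature.AnabelianGeometry.EtaleTheta (contMulAut mem_contMulAut TopOut innerContAut innerAut)
open Literature.AnabelianGeometry.SemiGraphs
open Literature.AnabelianGeometry.Anabelioids (IsSigmaInteger)
open Topology

universe u

namespace AbsTopII.DPSCIndexData

/-! ## §1. At an embedded datum -/

section Embedding

variable {P : Type u} [Group P] [TopologicalSpace P] [CompactSpace P]
  (G : PSCDatum P) (E : ProfiniteGrp.{u}) (ι : P →* E) (hιc : Continuous ι)
  (hιi : Function.Injective ι) (hιr : IsClosed (ι.range : Set E)) (hιn : ι.range.Normal)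
  (PiI : Subgroup E) (hIn : PiI.Normal) (hle : ι.range ≤ PiI)
  (σ : G.graph.N → ℕ) (hσ : ∀ e, IsSigmaInteger G.Sigma (σ e))

include hιc hιi

/-- **[AbsTopII] Prop 1.3 (v), middle clause AS TYPED (F-0300)** at every embedded datum: "`D_v ∩ Π_I =
C_{Π_I}(I_v) = N_{Π_I}(I_v) = Z_{Π_I}(I_v)` is commensurably terminal in `Π_I`", from graphicity of the
conjugation action, [CombGC] Prop 1.2 (ii)/(i) for `G`, slimness of the verticial subgroups, "`I_v ↠ I`",
"`I_v ≅ Ẑ^Σ`" and "(iv) at open subgroups" (`hL`). [cite: MochizukiAbsTopII2013, Prop 1.3 (v) p.12]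
[cite: MochizukiCombGC2007, Prop 1.2 p.8] -/
theorem prop_1_3_v'_ofEmbedding
    (hconj : ∀ h : E, ∃ φ : P ≃ₜ* P, (∀ x, h * ι x * h⁻¹ = ι (φ x)) ∧ G.IsGraphic G φ)
    (hCT : G.VerticialEdgeLikeCommensurablyTerminal) (hDetV : G.VerticialOpenInterDeterminesVertex)
    (hslimv : ∀ w, IsSlimGroup ↥(G.vertGp w))
    (hsurj : ∀ v, (DPSCData.ofEmbedding G E ι hιr hιn PiI hIn hle).Iv v ⊔
      (DPSCData.ofEmbedding G E ι hιr hιn PiI hIn hle).PiG = (DPSCData.ofEmbedding G E ι hιr hιn PiI hIn hle).PiI)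
    (hcyc : ∀ v, IsFreeProSigmaCyclic G.Sigma ↥((DPSCData.ofEmbedding G E ι hιr hιn PiI hIn hle).Iv v))
    (hL : ∀ (v : (DPSCData.ofEmbedding G E ι hιr hιn PiI hIn hle).Vert)
      (g : (DPSCData.ofEmbedding G E ι hιr hιn PiI hIn hle).PiH),
      (DPSCData.ofEmbedding G E ι hιr hιn PiI hIn hle).Iv v ⊓
          MulAut.conj g • (DPSCData.ofEmbedding G E ι hιr hιn PiI hIn hle).Iv v ≠ ⊥ →
        MulAut.conj g • (DPSCData.ofEmbedding G E ι hιr hιn PiI hIn hle).vertSub v =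
          (DPSCData.ofEmbedding G E ι hιr hιn PiI hIn hle).vertSub v) :
    Literature.AnabelianGeometry.AbsoluteAnabelian.AbsTopII.DPSCIndexData.Prop_1_3_v'
      (ofEmbedding G E ι hιr hιn PiI hIn hle σ hσ) := by
  obtain ⟨e, he⟩ := DPSCData.exists_rangeEquiv G E ι hιr hιn PiI hIn hle hιc hιi
  refine (ofEmbedding G E ι hιr hιn PiI hIn hle σ hσ).prop_1_3_v'_of_prop_1_3_iii'
    (prop_1_3_iii'_ofEmbedding G E ι hιc hιi hιr hιn PiI hIn hle σ hσ hCT hslimv hsurj hcyc) ?_ ?_ ?_ hL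
  · exact (DPSCData.ofEmbedding G E ι hιr hιn PiI hIn hle).graphic_vertSub_of_psc
      (G.mapAlong e.toMulEquiv.toMonoidHom e.continuous G.Sigma subset_rfl G.sigma_nonempty
        (G.proSigma.of_continuousMulEquiv e))
      Equiv.ulift (DPSCData.vertSub_presentation G E ι hιr hιn PiI hIn hle he)
      (DPSCData.graphic_presentation G E ι hιr hιn PiI hIn hle he hconj)
  · exact (DPSCData.ofEmbedding G E ι hιr hιn PiI hIn hle).vertDet_of_psc
      (G.mapAlong e.toMulEquiv.toMonoidHom e.continuous G.Sigma subset_rfl G.sigma_nonempty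
        (G.proSigma.of_continuousMulEquiv e))
      Equiv.ulift (DPSCData.vertSub_presentation G E ι hιr hιn PiI hIn hle he)
      ((PSCDatum.verticialOpenInterDeterminesVertex_mapAlong_equiv_iff G e _ _ _ _).mpr hDetV)
  · exact (DPSCData.ofEmbedding G E ι hιr hιn PiI hIn hle).isCommensurablyTerminal_vertSub_of_psc
      (G.mapAlong e.toMulEquiv.toMonoidHom e.continuous G.Sigma subset_rfl G.sigma_nonempty
        (G.proSigma.of_continuousMulEquiv e))
      Equiv.ulift (DPSCData.vertSub_presentation G E ι hιr hιn PiI hIn hle he)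
      ((PSCDatum.verticialEdgeLikeCommensurablyTerminal_mapAlong_equiv_iff G e _ _ _ _).mpr hCT)

/-- **[AbsTopII] Prop 1.3 (v), outer clauses AS TYPED (F-0278, t4's `DPSCData.Prop13v`)** at every
embedded datum — abc-iut-w5-d226's `prop13v_ofEmbedding` with its "`I_v` infinite" hypothesis DISCHARGED
from "`I_v ≅ Ẑ^Σ`" (a free pro-`Σ`-cyclic group is infinite, `Σ ≠ ∅`: `IsFreeProSigmaCyclic.infinite`).
[cite: MochizukiAbsTopII2013, Prop 1.3 (v) p.12] [cite: MochizukiCombGC2007, Prop 1.2 p.8] -/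
theorem prop13v_ofEmbedding_of_isFreeProSigmaCyclic
    (hconj : ∀ h : E, ∃ φ : P ≃ₜ* P, (∀ x, h * ι x * h⁻¹ = ι (φ x)) ∧ G.IsGraphic G φ)
    (hCT : G.VerticialEdgeLikeCommensurablyTerminal) (hDetV : G.VerticialOpenInterDeterminesVertex)
    (hcyc : ∀ v, IsFreeProSigmaCyclic G.Sigma ↥((DPSCData.ofEmbedding G E ι hιr hιn PiI hIn hle).Iv v))
    (hL : ∀ (v : (DPSCData.ofEmbedding G E ι hιr hιn PiI hIn hle).Vert)
      (g : (DPSCData.ofEmbedding G E ι hιr hιn PiI hIn hle).PiH),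
      (DPSCData.ofEmbedding G E ι hιr hιn PiI hIn hle).Iv v ⊓
          MulAut.conj g • (DPSCData.ofEmbedding G E ι hιr hιn PiI hIn hle).Iv v ≠ ⊥ →
        MulAut.conj g • (DPSCData.ofEmbedding G E ι hιr hιn PiI hIn hle).vertSub v =
          (DPSCData.ofEmbedding G E ι hιr hιn PiI hIn hle).vertSub v) :
    (DPSCData.ofEmbedding G E ι hιr hιn PiI hIn hle).Prop13v :=
  DPSCData.prop13v_ofEmbedding G E ι hιc hιi hιr hιn PiI hIn hle hconj hCT hDetV hL fun v => by
    obtain ⟨p, hp⟩ := G.sigma_nonempty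
    exact (hcyc v).infinite (G.sigma_prime p hp) hp

end Embedding

/-! ## §2. At the DPSC-extension of construction data -/

section OuterAction

variable {P : Type u} [Group P] [TopologicalSpace P] [IsTopologicalGroup P] [CompactSpace P]
  [TotallyDisconnectedSpace P] (G : PSCDatum P) (hG : IsTopologicallyFinitelyGenerated P)
  (hZ : Subgroup.center P = ⊥)
  {J : Type u} [Group J] [TopologicalSpace J] [IsTopologicalGroup J] [CompactSpace J]
  [TotallyDisconnectedSpace J] (θ : J →ₜ* outProfinite hG) (I : Subgroup J) [I.Normal]
  (σ : G.graph.N → ℕ) (hσ : ∀ e, IsSigmaInteger G.Sigma (σ e))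

include hZ

/-- **[AbsTopII] Prop 1.3 (v), middle clause AS TYPED (F-0300) at `Π_𝒢 ⋊^out_θ J`** from hypotheses on
the construction data — graphicity of the conjugation action (from graphic lifts of `θ`:
`isGraphic_conjAutOf_of_lifts`), [CombGC] Prop 1.2 (ii)/(i) for `G`, slimness of the verticial
subgroups, Π_v-fixing lifts of `ρ_I`, `I` closed with `I ≅ Ẑ^Σ` — plus row I-L "(iv) at open subgroups".
[cite: MochizukiAbsTopII2013, Prop 1.3 (v) p.12] [cite: MochizukiCombGC2007, Prop 1.2 p.8] -/
theorem prop_1_3_v'_ofOuterAction_of_dehn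
    (hgraphic : ∀ h : outerSemidirectProfinite hG θ, G.IsGraphic G (conjAutOf hG θ h))
    (hCT : G.VerticialEdgeLikeCommensurablyTerminal) (hDetV : G.VerticialOpenInterDeterminesVertex)
    (hslimv : ∀ w, IsSlimGroup ↥(G.vertGp w))
    (hDehn : ∀ (v : G.graph.V) (i : J), i ∈ I → ∃ φ : P ≃ₜ* P,
      TopOut.mk P ⟨φ.toMulEquiv, (mem_contMulAut P).mpr ⟨φ.continuous, φ.symm.continuous⟩⟩ =
        outerActionOfContinuous hG θ i ∧ ∀ x ∈ G.vertGp v, φ x = x)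
    (hIc : IsClosed (I : Set J)) (hI : IsFreeProSigmaCyclic G.Sigma ↥I)
    (hL : ∀ (v : (DPSCData.ofOuterAction G hG θ I).Vert) (g : (DPSCData.ofOuterAction G hG θ I).PiH),
      (DPSCData.ofOuterAction G hG θ I).Iv v ⊓ MulAut.conj g • (DPSCData.ofOuterAction G hG θ I).Iv v ≠ ⊥ →
        MulAut.conj g • (DPSCData.ofOuterAction G hG θ I).vertSub v =
          (DPSCData.ofOuterAction G hG θ I).vertSub v) :
    Literature.AnabelianGeometry.AbsoluteAnabelian.AbsTopII.DPSCIndexData.Prop_1_3_v'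
      (ofOuterAction G hG θ I σ hσ) :=
  prop_1_3_v'_ofEmbedding G _ _ (inlProfinite hG θ).continuous (inlProfinite_injective hG θ hZ) _ _ _ _ _
    σ hσ (DPSCData.hconj_ofOuterAction G hG θ hgraphic) hCT hDetV hslimv
    (fun v => DPSCData.Iv_sup_PiG_eq_PiI_ofOuterAction G hG θ I v (fun i hi => hDehn v.down i hi))
    (DPSCData.isFreeProSigmaCyclic_Iv_ofOuterAction G hG θ I hIc
      (DPSCData.prop13iii_ofOuterAction_of_fixing_lifts G hG hZ θ I hCT hslimv hDehn) hI)
    hL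

/-- **[AbsTopII] Prop 1.3 (v), outer clauses AS TYPED (F-0278) at `Π_𝒢 ⋊^out_θ J`** — abc-iut-w5-d226's
`prop13v_ofOuterAction` with "`I_v` infinite" DISCHARGED from "`I ≅ Ẑ^Σ`" (via `I_v ≃ₜ* I`).
[cite: MochizukiAbsTopII2013, Prop 1.3 (v) p.12] [cite: MochizukiCombGC2007, Prop 1.2 p.8] -/
theorem prop13v_ofOuterAction_of_dehn
    (hgraphic : ∀ h : outerSemidirectProfinite hG θ, G.IsGraphic G (conjAutOf hG θ h))
    (hCT : G.VerticialEdgeLikeCommensurablyTerminal) (hDetV : G.VerticialOpenInterDeterminesVertex)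
    (hslimv : ∀ w, IsSlimGroup ↥(G.vertGp w))
    (hDehn : ∀ (v : G.graph.V) (i : J), i ∈ I → ∃ φ : P ≃ₜ* P,
      TopOut.mk P ⟨φ.toMulEquiv, (mem_contMulAut P).mpr ⟨φ.continuous, φ.symm.continuous⟩⟩ =
        outerActionOfContinuous hG θ i ∧ ∀ x ∈ G.vertGp v, φ x = x)
    (hIc : IsClosed (I : Set J)) (hI : IsFreeProSigmaCyclic G.Sigma ↥I)
    (hL : ∀ (v : (DPSCData.ofOuterAction G hG θ I).Vert) (g : (DPSCData.ofOuterAction G hG θ I).PiH),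
      (DPSCData.ofOuterAction G hG θ I).Iv v ⊓ MulAut.conj g • (DPSCData.ofOuterAction G hG θ I).Iv v ≠ ⊥ →
        MulAut.conj g • (DPSCData.ofOuterAction G hG θ I).vertSub v =
          (DPSCData.ofOuterAction G hG θ I).vertSub v) :
    (DPSCData.ofOuterAction G hG θ I).Prop13v :=
  DPSCData.prop13v_ofOuterAction G hG hZ θ I hgraphic hCT hDetV hL fun v => by
    obtain ⟨p, hp⟩ := G.sigma_nonempty
    exact (DPSCData.isFreeProSigmaCyclic_Iv_ofOuterAction G hG θ I hIc
      (DPSCData.prop13iii_ofOuterAction_of_fixing_lifts G hG hZ θ I hCT hslimv hDehn) hI v).infinite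
      (G.sigma_prime p hp) hp

end OuterAction

end AbsTopII.DPSCIndexData

end Literature.AnabelianGeometry.AbsoluteAnabelian

end
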